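import Summits.KontsevichZagierPeriods.Zeta5Search.WedgeDictionaryRankThree
import Summits.KontsevichZagierPeriods.Zeta5Search.WedgeDictionaryGaugeStep
import HarnessLib

/-!
# CF-W3 PROVED: the closed form of the rank-three Casoratian `det(U, W, V)` (`rankThreeClosedForm_holds`)

HONEST FRAMING: systematic search; no irrationality claim unless certified.

OUR work (Summit side; cell `pub-zeta5`, P1 seat generation 4, 2026-08-20).  The conjecture CF-W3
`rankThreeClosedForm` (planner gen-1 g5, `WedgeDictionaryRankThree`; 837 + 128 exact instances) is a THEOREM:
for `b` in the box with `b₇ + 2 ≤ N`, `d(b) ≥ 1` and all pair sums `b_j + b_k ≤ N`,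
`cas3(b) · ∏_{j<k} (N − b_j − b_k)! = (−1)^{N+1} · 4 · (d−1)! · ∏_j b_j!`.
It is an identity of rational numbers (no irrationality content).

PROOF (no separate base identity `BASE(N)` is needed — the corner is a face point):
* INTRINSIC FORM (`cas3_eq_dir`).  The slot-7 Casoratian `cas3 b` (rows at `b, b+e₇, b+2e₇`) equals the same
  determinant with rows at `b, b+e_i, b+2e_i` for every other slot `i`: the numerator polynomials satisfy the exact
  contiguity `Pr(b+e_i) − Pr(b+e₇) = (c_i − c₇)·Pr(b)`, `c_j = b_j(N − b_j)` (`numPoly_update`), a summable combination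
  with ZERO telescoper, so `(U,W,V)(b+e_i) = (U,W,V)(b+e₇) + (c_i − c₇)(U,W,V)(b)` (`coeff_contiguity`, from
  `coeff_rel_of_summable` and `coeffV_rel_of_summable4` with `g = 0`); row operations do the rest.
* FACE `b₇ = 0` (`face_cas3`, `rankThree_face`).  lit g4's three-term face relation `face_threeTerm`
  (`d·Pr(b+2e_i) + γ₁Pr(b+e_i) + γ₀Pr(b) = g(X+1)X⁶ − g(X+N)⁶`, `g = −h_b`) kills the `U`- and `W`-combinations
  (`coeff_rel_of_summable`) and gives the `V`-combination the BOUNDARY TERM `ε(b) = g(1)/(N!)⁶ = −N!·∏_j b_j!/(N−b_j)!`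
  (gen-1 g5's `coeffV_rel_of_summable4`; `hPoly_eval_one`).  Hence `d·cas3(b) = ε·(U(b)W(b+e_i) − U(b+e_i)W(b)) = ε·M₃(b)`
  (`wedgeQ_eq_quadM3`), and CF-W3 on the face follows from CF-M3 on the face (`casoratianClosedForm_face`, `Ω = 1`).
  This is the mechanism behind "the harmonic numbers inside `V` cancel in the determinant".
* INTERIOR: induction on `b₇` by Abel's step `cas3_abel_step` (`γ₃ = −(d−1)`, `γ₀ = (b₇+1)∏_{k≤6}(N−b₇−b_k)`) and the
  slot-7 bookkeeping `pairProd_slot7_step`.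
Exact numerical control of every step: `run/shared/lean/pub/pub-zeta5/code/p1/g4/face_check.py` (0 failures in
1639 + 895 + 895 checks, `N ≤ 7`).
-/

open Finset Polynomial

namespace Summit.KontsevichZagierPeriods.Zeta5Search.WedgeDictionary

open Summit.KontsevichZagierPeriods.Zeta5Search.DualSeries
open Literature.NumberTheory.Transcendental
open Literature.NumberTheory.Transcendental.BallRivoal (poch_natCast_succ)

namespace CFW3

/-! ### Coefficient contiguity and the intrinsic form of `cas3` -/

/-- Slot bumps in different slots commute. -/
theorem bump_bump_comm (b : ℕ → ℤ) {i k : ℕ} (h : i ≠ k) : bump (bump b i) k = bump (bump b k) i := by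
  funext j
  by_cases hj : j = k + 1
  · subst hj
    rw [bump_self, bump_of_ne b (show k + 1 ≠ i + 1 by omega), bump_of_ne _ (show k + 1 ≠ i + 1 by omega), bump_self]
  · by_cases hj' : j = i + 1
    · subst hj'
      rw [bump_of_ne _ hj, bump_self, bump_self, bump_of_ne b hj]
    · rw [bump_of_ne _ hj, bump_of_ne _ hj', bump_of_ne _ hj', bump_of_ne _ hj]

/-- **Coefficient contiguity.** For `b` in the box with `d(b) ≥ 0`, a slot `i+1 ≤ 6` with `b_{i+1} ≤ N` and `b₇ ≤ N`:
`X(b+e_{i+1}) = X(b+e₇) + (c_{i+1} − c₇)·X(b)` for `X ∈ {U, W, V}`, `c_j = b_j(N − b_j)` — the exact polynomial identity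
`Pr(b+e_{i+1}) − Pr(b+e₇) = (c_{i+1} − c₇)Pr(b)` is a summable combination with zero telescoper. -/
theorem coeff_contiguity (b : ℕ → ℤ) (hb : InBox b) (hd : 0 ≤ dOf b) {i : ℕ} (hi : i ∈ range 6)
    (hbi : b (i + 1) ≤ b 0) (h7 : b 7 ≤ b 0) (hN : 1 ≤ (b 0).toNat) :
    (coeffU (bump b i) = coeffU (bump b 6) +
        ((b (i + 1) : ℚ) * ((b 0 : ℚ) - b (i + 1)) - (b 7 : ℚ) * ((b 0 : ℚ) - b 7)) * coeffU b) ∧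
      (coeffW (bump b i) = coeffW (bump b 6) +
        ((b (i + 1) : ℚ) * ((b 0 : ℚ) - b (i + 1)) - (b 7 : ℚ) * ((b 0 : ℚ) - b 7)) * coeffW b) ∧
      (coeffV (bump b i) = coeffV (bump b 6) +
        ((b (i + 1) : ℚ) * ((b 0 : ℚ) - b (i + 1)) - (b 7 : ℚ) * ((b 0 : ℚ) - b 7)) * coeffV b) := by
  have hi6 := mem_range.1 hi
  have hi7 : i ∈ range 7 := mem_range.2 (by omega)
  have h67 : (6 : ℕ) ∈ range 7 := mem_range.2 (by norm_num)
  have hβ0 : 0 ≤ b (i + 1) := (hb.2 i hi7).1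
  have h70 : 0 ≤ b 7 := (hb.2 6 h67).1
  obtain ⟨hbi', hsi'⟩ := box_update b hb hd hi7 hbi
  change InBox (bump b i) at hbi'
  change ∑ l ∈ range 7, bump b i (l + 1) ≤ 3 * bump b i 0 + 1 at hsi'
  obtain ⟨hb7', hs7'⟩ := box_update b hb hd h67 h7
  change InBox (bump b 6) at hb7'
  change ∑ l ∈ range 7, bump b 6 (l + 1) ≤ 3 * bump b 6 0 + 1 at hs7'
  have hs : ∑ j ∈ range 7, b (j + 1) ≤ 3 * b 0 + 1 := sum_le_of_dOf b hd
  have e1 : numPoly (bump b i) = numPoly b * ((X + C (b (i + 1) : ℚ)) * (X + C ((b 0 - b (i + 1) : ℤ) : ℚ))) :=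
    numPoly_update b hi7 hβ0
  have e2 : numPoly (bump b 6) = numPoly b * ((X + C (b 7 : ℚ)) * (X + C ((b 0 - b 7 : ℤ) : ℚ))) :=
    numPoly_update b h67 h70
  set s : ℚ := (b (i + 1) : ℚ) * ((b 0 : ℚ) - b (i + 1)) - (b 7 : ℚ) * ((b 0 : ℚ) - b 7) with hs_def
  have hrel : C (1 : ℚ) * numPoly (bump b i) + C (-1 : ℚ) * numPoly (bump b 6) + C (-s) * numPoly b =
      (0 : ℚ[X]).comp (X + C 1) * X ^ 6 - 0 * (X + C (((b 0).toNat : ℕ) : ℚ)) ^ 6 := by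
    rw [e1, e2, zero_comp, zero_mul, zero_mul, sub_zero, hs_def]
    simp only [Int.cast_sub, map_sub, map_mul, map_neg, map_one]
    ring
  have hg : (0 : ℚ[X]).natDegree + 1 ≤ 6 * (b 0).toNat := by rw [natDegree_zero]; omega
  obtain ⟨hU, hW⟩ := coeff_rel_of_summable (bump b i) (bump b 6) b (b 0).toNat hN hbi' hb7' hb hsi' hs7' hs
    (by rw [bump_zero]) (by rw [bump_zero]) rfl 1 (-1) (-s) 0 hg hrel
  have hV := coeffV_rel_of_summable4 (bump b i) (bump b 6) b b (b 0).toNat hN hbi' hb7' hb hb hsi' hs7' hs hs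
    (by rw [bump_zero]) (by rw [bump_zero]) rfl rfl 1 (-1) (-s) 0 0 hg
    (by rw [map_zero, zero_mul, add_zero]; exact hrel)
  rw [eval_zero, zero_div] at hV
  refine ⟨?_, ?_, ?_⟩
  · linear_combination hU
  · linear_combination hW
  · linear_combination hV

/-- **The Casoratian is intrinsic**: for `b` in the box with `d(b) ≥ 1`, `b₇ + 1 ≤ N` and a slot `i+1 ≤ 6` with
`b_{i+1} + 1 ≤ N`, the slot-7 determinant `cas3 b` equals the determinant of `(U,W,V)` at `b, b+e_{i+1}, b+2e_{i+1}`. -/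
theorem cas3_eq_dir (b : ℕ → ℤ) (hb : InBox b) (hd : 1 ≤ dOf b) {i : ℕ} (hi : i ∈ range 6)
    (hbi : b (i + 1) + 1 ≤ b 0) (h7 : b 7 + 1 ≤ b 0) :
    cas3 b =
      coeffU b * (coeffW (bump b i) * coeffV (bump (bump b i) i) - coeffV (bump b i) * coeffW (bump (bump b i) i)) -
        coeffW b * (coeffU (bump b i) * coeffV (bump (bump b i) i) - coeffV (bump b i) * coeffU (bump (bump b i) i)) +
        coeffV b * (coeffU (bump b i) * coeffW (bump (bump b i) i) - coeffW (bump b i) * coeffU (bump (bump b i) i)) := by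
  have hi6 := mem_range.1 hi
  have hi7 : i ∈ range 7 := mem_range.2 (by omega)
  have h67 : (6 : ℕ) ∈ range 7 := mem_range.2 (by norm_num)
  have h70 : 0 ≤ b 7 := (hb.2 6 h67).1
  have hN : 1 ≤ (b 0).toNat := by omega
  have hd0 : 0 ≤ dOf b := by omega
  -- the three points where contiguity is applied: b, b' = b + e_{i+1}, b'' = b + e₇
  have hB' : InBox (bump b i) := inBox_update b hb hi7 (by omega)
  have hB'' : InBox (bump b 6) := inBox_update b hb h67 (show b 7 ≤ b 0 by omega)
  have hd' : 0 ≤ dOf (bump b i) := by rw [dOf_bump b hi7]; omega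
  have hd'' : 0 ≤ dOf (bump b 6) := by rw [dOf_bump b h67]; omega
  obtain ⟨hU0, hW0, hV0⟩ := coeff_contiguity b hb hd0 hi (by omega) (by omega) hN
  obtain ⟨hU1, hW1, hV1⟩ := coeff_contiguity (bump b i) hB' hd' hi
    (by rw [bump_self, bump_zero]; exact hbi) (by rw [bump_of_ne b (by omega), bump_zero]; omega)
    (by rw [bump_zero]; exact hN)
  obtain ⟨hU2, hW2, hV2⟩ := coeff_contiguity (bump b 6) hB'' hd'' hi
    (by rw [bump_of_ne b (by omega), bump_zero]; omega)
    (by rw [show bump b 6 7 = b 7 + 1 from bump_self b 6, bump_zero]; exact h7) (by rw [bump_zero]; exact hN)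
  have hc : bump (bump b i) 6 = bump (bump b 6) i := bump_bump_comm b (by omega)
  rw [hc] at hU1 hW1 hV1
  rw [hU2] at hU1
  rw [hW2] at hW1
  rw [hV2] at hV1
  rw [hU1, hW1, hV1, hU0, hW0, hV0]
  unfold cas3
  ring

/-! ### The face `b₇ = 0`: the boundary term of the constant terms -/

/-- **The face formula.** For `b` in the box with `b₇ = 0`, `d(b) ≥ 1` and a slot `i+1 ≤ 6` with `b_{i+1} + 1 ≤ N`:
`d(b) · cas3(b) = ε(b) · M₃(b)` with `ε(b) = g(1)/((1)_N)⁶`, `g = −h_b` — the boundary term of the `V`-version of the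
three-term face relation (the `U`- and `W`-combinations vanish). -/
theorem face_cas3 (b : ℕ → ℤ) (hb : InBox b) (h7 : b 7 = 0) (hd : 1 ≤ dOf b) {i : ℕ} (hi : i ∈ range 6)
    (hbi : b (i + 1) + 1 ≤ b 0) :
    (dOf b : ℚ) * cas3 b = (-hPoly b).eval 1 / BallRivoal.poch 1 (b 0).toNat ^ 6 * quadM3 b := by
  have hi6 := mem_range.1 hi
  have hi7 : i ∈ range 7 := mem_range.2 (by omega)
  have hβ0 : 0 ≤ b (i + 1) := (hb.2 i hi7).1
  have hd0 : 0 ≤ dOf b := by omega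
  have hle : b (i + 1) ≤ b 0 := by omega
  have hN : 1 ≤ (b 0).toNat := by omega
  rw [cas3_eq_dir b hb hd hi hbi (by rw [h7]; omega)]
  -- the three points b, b' = b + e, b'' = b + 2e
  obtain ⟨hb', hs'⟩ := box_update b hb hd0 hi7 hle
  change InBox (bump b i) at hb'
  change ∑ l ∈ range 7, bump b i (l + 1) ≤ 3 * bump b i 0 + 1 at hs'
  have hd0' : 0 ≤ dOf (bump b i) := by rw [dOf_bump b hi7]; omega
  have hle' : bump b i (i + 1) ≤ bump b i 0 := by rw [bump_self, bump_zero]; exact hbi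
  obtain ⟨hb'', hs''⟩ := box_update (bump b i) hb' hd0' hi7 hle'
  change InBox (bump (bump b i) i) at hb''
  change ∑ l ∈ range 7, bump (bump b i) i (l + 1) ≤ 3 * bump (bump b i) i 0 + 1 at hs''
  have hs : ∑ j ∈ range 7, b (j + 1) ≤ 3 * b 0 + 1 := sum_le_of_dOf b hd0
  -- the coefficient relations: U, W vanish, V has the boundary term
  obtain ⟨hU, hW⟩ := coeff_rel_of_summable (bump (bump b i) i) (bump b i) b (b 0).toNat hN hb'' hb' hb hs'' hs' hs
    (by rw [bump_zero, bump_zero]) (by rw [bump_zero]) rfl (dOf b : ℚ) (faceGamma1 b i) (faceGamma0 b i) (-hPoly b)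
    (natDegree_neg_hPoly_succ_le b hb hd) (face_threeTerm b hb h7 hi)
  have hV := coeffV_rel_of_summable4 (bump (bump b i) i) (bump b i) b b (b 0).toNat hN hb'' hb' hb hb hs'' hs' hs hs
    (by rw [bump_zero, bump_zero]) (by rw [bump_zero]) rfl rfl (dOf b : ℚ) (faceGamma1 b i) (faceGamma0 b i) 0
    (-hPoly b) (natDegree_neg_hPoly_succ_le b hb hd)
    (by rw [map_zero, zero_mul, add_zero]; exact face_threeTerm b hb h7 hi)
  have hq : coeffU b * coeffW (bump b i) - coeffU (bump b i) * coeffW b = quadM3 b :=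
    wedgeQ_eq_quadM3 b hb hd0 hi7 hle
  set ε := (-hPoly b).eval 1 / BallRivoal.poch 1 (b 0).toNat ^ 6 with hε
  linear_combination (coeffW b * coeffV (bump b i) - coeffV b * coeffW (bump b i)) * hU +
    (coeffV b * coeffU (bump b i) - coeffU b * coeffV (bump b i)) * hW +
    (coeffU b * coeffW (bump b i) - coeffW b * coeffU (bump b i)) * hV + ε * hq

/-- The face telescoper at `1`: `h_b(1) · ∏_j (N − b_j)! = ∏_j b_j! · (N!)⁷` (for `0 ≤ b_j ≤ N`). -/
theorem hPoly_eval_one (b : ℕ → ℤ) (hb : InBox b) (hle : ∀ j ∈ range 7, b (j + 1) ≤ b 0) :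
    (hPoly b).eval 1 * ∏ j ∈ range 7, (((b 0 - b (j + 1)).toNat.factorial : ℕ) : ℚ) =
      (∏ j ∈ range 7, (((b (j + 1)).toNat.factorial : ℕ) : ℚ)) * (((b 0).toNat.factorial : ℕ) : ℚ) ^ 7 := by
  rw [eval_hPoly, ← prod_mul_distrib,
    show (((b 0).toNat.factorial : ℕ) : ℚ) ^ 7 = ∏ _j ∈ range 7, (((b 0).toNat.factorial : ℕ) : ℚ) by
      rw [prod_const, card_range],
    ← prod_mul_distrib]
  refine prod_congr rfl fun j hj => ?_
  set m := (b (j + 1)).toNat with hm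
  set M := (b 0 - b (j + 1)).toNat with hM
  have hβ0 : 0 ≤ b (j + 1) := (hb.2 j hj).1
  have hMm : M + m = (b 0).toNat := by have := hle j hj; omega
  have hcast : ((b 0 - b (j + 1) : ℤ) : ℚ) = (M : ℚ) := by
    have : ((M : ℕ) : ℤ) = b 0 - b (j + 1) := Int.toNat_of_nonneg (by have := hle j hj; omega)
    exact_mod_cast this.symm
  have h1 : BallRivoal.poch (1 : ℚ) m = (m.factorial : ℚ) := by
    have := poch_natCast_succ 0 m
    simp only [Nat.cast_zero, zero_add, Nat.choose_self, Nat.cast_one, mul_one] at this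
    exact this
  have h2 : BallRivoal.poch (1 + (M : ℚ)) m * (M.factorial : ℚ) = ((b 0).toNat.factorial : ℚ) := by
    rw [add_comm, poch_natCast_succ M m, ← hMm]
    have key : (M + m).choose m * m.factorial * M.factorial = (M + m).factorial := by
      have := Nat.choose_mul_factorial_mul_factorial (Nat.le_add_left m M)
      rw [Nat.add_sub_cancel] at this
      exact this
    have key' : (((M + m).choose m : ℕ) : ℚ) * (m.factorial : ℚ) * (M.factorial : ℚ) = ((M + m).factorial : ℚ) := by
      exact_mod_cast key
    linear_combination key'
  rw [hcast, h1]
  linear_combination (m.factorial : ℚ) * h2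

/-- All slots are `≤ N` under the pair bounds. -/
theorem le_of_allPairs {b : ℕ → ℤ} (hb : InBox b) (hpairs : ∀ jk ∈ allPairs, b jk.1 + b jk.2 ≤ b 0) :
    ∀ j ∈ Icc 1 7, b j ≤ b 0 := by
  intro j hj
  obtain ⟨hj1, hj7⟩ := mem_Icc.1 hj
  by_cases h1 : j = 1
  · subst h1
    have h := hpairs (1, 2) (by simp [allPairs])
    have h20 : 0 ≤ b 2 := (hb.2 1 (by simp)).1
    dsimp only at h
    omega
  · have h := pair_le_of_allPairs hpairs (j := 1) (k := j) le_rfl (by norm_num) hj1 hj7 (Ne.symm h1)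
    have h10 : 0 ≤ b 1 := (hb.2 0 (by simp)).1
    omega

/-- **CF-W3 on the face `b₇ = 0`, through a chosen direction.** -/
theorem rankThree_face_dir (b : ℕ → ℤ) (hb : InBox b) (hd : 1 ≤ dOf b)
    (hpairs : ∀ jk ∈ allPairs, b jk.1 + b jk.2 ≤ b 0) (h7 : b 7 = 0) {i : ℕ} (hi : i ∈ range 6)
    (hbi : b (i + 1) + 1 ≤ b 0) :
    cas3 b * (allPairs.map fun jk => ((b 0 - b jk.1 - b jk.2).toNat.factorial : ℚ)).prod =
      (-1 : ℚ) ^ ((b 0).toNat + 1) * 4 * ((dOf b - 1).toNat.factorial : ℚ) *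
        ∏ j ∈ range 7, ((b (j + 1)).toNat.factorial : ℚ) := by
  have hd0 : 0 ≤ dOf b := by omega
  have hle := le_of_allPairs hb hpairs
  have hle' : ∀ j ∈ range 7, b (j + 1) ≤ b 0 := fun j hj =>
    hle (j + 1) (mem_Icc.2 ⟨by omega, by have := mem_range.1 hj; omega⟩)
  have key := face_cas3 b hb h7 hd hi hbi
  have cf := casoratianClosedForm_face b hb hd0 hle hpairs h7
  rw [omegaVWP_eq_one (j := 6) (by simp) h7, mul_one] at cf
  have hh := hPoly_eval_one b hb hle'
  have hN : BallRivoal.poch (1 : ℚ) (b 0).toNat = (((b 0).toNat.factorial : ℕ) : ℚ) := by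
    have := poch_natCast_succ 0 (b 0).toNat
    simp only [Nat.cast_zero, zero_add, Nat.choose_self, Nat.cast_one, mul_one] at this
    exact this
  have hdf : (((dOf b).toNat.factorial : ℕ) : ℚ) = (dOf b : ℚ) * (((dOf b - 1).toNat.factorial : ℕ) : ℚ) := by
    rw [show dOf b = (dOf b - 1) + 1 by ring, toNat_factorial_succ _ (by omega)]
    push_cast
    ring
  rw [eval_neg, hN] at key
  set Nf : ℚ := (((b 0).toNat.factorial : ℕ) : ℚ) with hNf
  set P : ℚ := (allPairs.map fun jk => ((b 0 - b jk.1 - b jk.2).toNat.factorial : ℚ)).prod with hP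
  set F : ℚ := ∏ j ∈ range 7, (((b 0 - b (j + 1)).toNat.factorial : ℕ) : ℚ) with hF
  set B : ℚ := ∏ j ∈ range 7, (((b (j + 1)).toNat.factorial : ℕ) : ℚ) with hB
  set h1 : ℚ := (hPoly b).eval 1 with hh1
  set q : ℚ := quadM3 b with hq
  have hNf0 : Nf ≠ 0 := by rw [hNf]; positivity
  have hd1 : (dOf b : ℚ) ≠ 0 := by exact_mod_cast (show dOf b ≠ 0 by omega)
  have key' : (dOf b : ℚ) * cas3 b * Nf ^ 6 = -h1 * q := by
    rw [key]; field_simp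
  apply mul_left_cancel₀ (mul_ne_zero hd1 (pow_ne_zero 7 hNf0))
  linear_combination (Nf * P) * key' + (-h1) * cf +
    (-((-1 : ℚ) ^ (b 0).toNat * 4 * (((dOf b).toNat.factorial : ℕ) : ℚ))) * hh +
    (-((-1 : ℚ) ^ (b 0).toNat * 4 * B * Nf ^ 7)) * hdf

/-- **CF-W3 on the face `b₇ = 0`.** -/
theorem rankThree_face (b : ℕ → ℤ) (hb : InBox b) (h72 : b 7 + 2 ≤ b 0) (hd : 1 ≤ dOf b)
    (hpairs : ∀ jk ∈ allPairs, b jk.1 + b jk.2 ≤ b 0) (h7 : b 7 = 0) :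
    cas3 b * (allPairs.map fun jk => ((b 0 - b jk.1 - b jk.2).toNat.factorial : ℚ)).prod =
      (-1 : ℚ) ^ ((b 0).toNat + 1) * 4 * ((dOf b - 1).toNat.factorial : ℚ) *
        ∏ j ∈ range 7, ((b (j + 1)).toNat.factorial : ℚ) := by
  by_cases h1 : b 1 + 1 ≤ b 0
  · exact rankThree_face_dir b hb hd hpairs h7 (i := 0) (by simp) h1
  · have h12 := hpairs (1, 2) (by simp [allPairs])
    have h20 : 0 ≤ b 2 := (hb.2 1 (by simp)).1
    dsimp only at h12
    exact rankThree_face_dir b hb hd hpairs h7 (i := 1) (by simp) (show b 2 + 1 ≤ b 0 by omega)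

/-! ### The interior: induction along slot 7 by Abel's step -/

/-- `∏_j b_j!` along a slot-7 step: `∏_j (a+e₇)_j! = (a₇ + 1) · ∏_j a_j!` (`a₇ ≥ 0`). -/
theorem slotFactorials_step (a : ℕ → ℤ) (h7 : 0 ≤ a 7) :
    ∏ j ∈ range 7, (((bump a 6 (j + 1)).toNat.factorial : ℕ) : ℚ) =
      ((a 7 : ℚ) + 1) * ∏ j ∈ range 7, (((a (j + 1)).toNat.factorial : ℕ) : ℚ) := by
  conv_lhs => rw [prod_range_succ]
  conv_rhs => rw [prod_range_succ]
  have hsame : ∏ j ∈ range 6, (((bump a 6 (j + 1)).toNat.factorial : ℕ) : ℚ) =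
      ∏ j ∈ range 6, (((a (j + 1)).toNat.factorial : ℕ) : ℚ) :=
    prod_congr rfl fun j hj => by rw [bump_of_ne a (by have := mem_range.1 hj; omega)]
  rw [hsame, show bump a 6 (6 + 1) = a 7 + 1 from bump_self a 6, show a (6 + 1) = a 7 from rfl,
    toNat_factorial_succ _ h7]
  ring

/-- CF-W3 by induction on `b₇` (base: the face; step: `cas3_abel_step`). -/
theorem rankThree_induct (t : ℕ) : ∀ b : ℕ → ℤ, (b 7).toNat = t → InBox b → b 7 + 2 ≤ b 0 → 1 ≤ dOf b →
    (∀ jk ∈ allPairs, b jk.1 + b jk.2 ≤ b 0) →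
    cas3 b * (allPairs.map fun jk => ((b 0 - b jk.1 - b jk.2).toNat.factorial : ℚ)).prod =
      (-1 : ℚ) ^ ((b 0).toNat + 1) * 4 * ((dOf b - 1).toNat.factorial : ℚ) *
        ∏ j ∈ range 7, ((b (j + 1)).toNat.factorial : ℚ) := by
  induction t with
  | zero =>
    intro b ht hb h72 hd hpairs
    have h70 : 0 ≤ b 7 := (hb.2 6 (by simp)).1
    exact rankThree_face b hb h72 hd hpairs (by omega)
  | succ t ih =>
    intro b ht hb h72 hd hpairs
    have h70 : 0 ≤ b 7 := (hb.2 6 (by simp)).1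
    have hd0 : 0 ≤ dOf b := by omega
    have hle := le_of_allPairs hb hpairs
    -- lower slot 7 by one
    set a : ℕ → ℤ := Function.update b 7 (b 7 - 1) with hadef
    have e1 : bump a 6 = b := by
      rw [hadef, OmegaRec.bump_update7, sub_add_cancel, Function.update_eq_self]
    have ha0 : a 0 = b 0 := Function.update_of_ne (by norm_num) _ _
    have ha7 : a 7 = b 7 - 1 := Function.update_self _ _ _
    have har : ∀ i ∈ range 6, a (i + 1) = b (i + 1) := fun i hi =>
      Function.update_of_ne (by have := mem_range.1 hi; omega) _ _
    obtain ⟨hA, -, -, hpA⟩ := OmegaRec.lowered_admissible b hb hd0 hle hpairs (b 7 - 1) (by omega) (by omega)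
    have hdA : dOf a = dOf b + 1 := by rw [hadef, OmegaRec.dOf_update7]; ring
    have IH := ih a (by rw [ha7]; omega) hA (by rw [ha7, ha0]; omega) (by rw [hdA]; omega) hpA
    -- Abel's step at `a`
    set Pr : ℚ := ∏ k ∈ range 6, ((b 0 : ℚ) - b 7 + 1 - b (k + 1)) with hPr
    have hg3 : topGamma3 a = -(dOf b : ℚ) := by rw [topGamma3_eq, hdA]; push_cast; ring
    have hg0 : topGamma0 a = (b 7 : ℚ) * Pr := by
      rw [topGamma0_eq, ha7, ha0]
      push_cast
      rw [show (b 7 : ℚ) - 1 + 1 = (b 7 : ℚ) by ring]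
      congr 1
      exact prod_congr rfl fun k hk => by rw [har k hk]; ring
    have abel0 := cas3_abel_step a hA (by rw [hdA]; omega) (by rw [ha7, ha0]; omega)
    rw [e1, hg3, hg0] at abel0
    -- bookkeeping of the pair factorials, the slot factorials and `(d-1)!`
    have hp7 : ∀ i ∈ range 6, a (i + 1) + a 7 + 1 ≤ a 0 := by
      intro i hi
      have hi6 := mem_range.1 hi
      rw [har i hi, ha7, ha0]
      have := pair_le_of_allPairs hpairs (j := i + 1) (k := 7) (by omega) (by omega) (by norm_num) le_rfl (by omega)
      omega
    have hP := pairProd_slot7_step a hp7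
    rw [e1] at hP
    simp only [ha0] at hP
    have hprod : ∏ i ∈ range 6, ((b 0 : ℚ) - a (i + 1) - a 7) = Pr :=
      prod_congr rfl fun k hk => by rw [har k hk, ha7]; push_cast; ring
    rw [hprod] at hP
    have hB := slotFactorials_step a (by rw [ha7]; omega)
    rw [e1, ha7] at hB
    push_cast at hB
    have hD : (((dOf a - 1).toNat.factorial : ℕ) : ℚ) = (dOf b : ℚ) * (((dOf b - 1).toNat.factorial : ℕ) : ℚ) := by
      rw [hdA, add_sub_cancel_right, show dOf b = (dOf b - 1) + 1 by ring, toNat_factorial_succ _ (by omega)]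
      push_cast; ring
    simp only [ha0] at IH
    rw [hD] at IH
    have hd1 : (dOf b : ℚ) ≠ 0 := by exact_mod_cast (show dOf b ≠ 0 by omega)
    apply mul_left_cancel₀ hd1
    set P : ℚ := (allPairs.map fun jk => ((b 0 - b jk.1 - b jk.2).toNat.factorial : ℚ)).prod with hPdef
    set Df1 : ℚ := (((dOf b - 1).toNat.factorial : ℕ) : ℚ) with hDf1
    linear_combination (-P) * abel0 + (-(b 7 : ℚ) * cas3 a) * hP + (b 7 : ℚ) * IH +
      (-(dOf b : ℚ) * (-1) ^ ((b 0).toNat + 1) * 4 * Df1) * hB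

end CFW3

/-- **CF-W3** (`rankThreeClosedForm`, planner gen-1 g5's conjecture on the rank-three Casoratian `det(U, W, V)` along
slot 7) **is a theorem**: `cas3(b) · ∏_{j<k} (N − b_j − b_k)! = (−1)^{N+1} · 4 · (d−1)! · ∏_j b_j!` for every `b` in the box
with `b₇ + 2 ≤ N`, `d(b) ≥ 1` and all pair sums `≤ N`. -/
theorem rankThreeClosedForm_holds : rankThreeClosedForm :=
  fun b hb h72 hd hpairs => CFW3.rankThree_induct _ b rfl hb h72 hd hpairs

end Summit.KontsevichZagierPeriods.Zeta5Search.WedgeDictionary
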